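import Mathlib

/-!
# Quotient-derivative numerators (route `ChowBorderDepth3`, crux `ChowBorderBound`, line `registered`)

Objects posited by the bounded-top-fan-in line of crux `stmt-ValiantsHypothesis-5936`
(`Summit.ValiantsHypothesis.ValiantsHypothesis.Theses.ChowBorderDepth3.ChowBorderBound`).

The exact divide–derive calculus (Dutta–Dwivedi–Saxena, FOCS 2021, "DiDIL") differentiates
QUOTIENTS `f / g` of polynomials.  To stay inside `MvPolynomial` (no fraction field, no power
series) we carry the canonical numerator instead: for a word `w = [v₁, …, v_t]` of variables,

  `quotDerivNum f g w = g^(t+1) · ∂_{v₁} ⋯ ∂_{v_t} (f / g)`   (computed in any field containing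
  the polynomial ring; derivatives applied right to left),

defined by the quotient rule as a recursion on the word:
`quotDerivNum f g [] = f`,
`quotDerivNum f g (v :: w) = g · ∂_v (quotDerivNum f g w) − (|w| + 1) · quotDerivNum f g w · ∂_v g`
(indeed `∂_v (N / g^(k)) = (g ∂_v N − k N ∂_v g) / g^(k+1)`).  Only this definition and its
defining equations / linearity live here; everything else rides with the proofs that use it.

References: P. Dutta, P. Dwivedi, N. Saxena, *Demystifying the border of depth-3 algebraic
circuits*, FOCS 2021 / SIAM J. Comput. (DiDIL, §3); folklore calculus.
-/

-- `Summit.ValiantsHypothesis.ValiantsHypothesis.…` is the tree's mandated single-conjunct layout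
-- (Sub = Summit), so the duplicated namespace component is intended.
set_option linter.dupNamespace false

namespace Summit.ValiantsHypothesis.ValiantsHypothesis.Theorems.ChowBorderBound.QuotDeriv

open MvPolynomial

variable {ι R : Type*} [CommRing R]

/-- **Quotient-derivative numerator.**  `quotDerivNum f g w` is the polynomial
`g^(|w|+1) · ∂_w (f / g)`, where `∂_w = ∂_{v₁} ∘ ⋯ ∘ ∂_{v_t}` for `w = [v₁, …, v_t]` (partial
derivatives `MvPolynomial.pderiv`, applied right to left), defined WITHOUT leaving the polynomial
ring by the quotient rule: `∂_v (N / g^(k)) = (g · ∂_v N − k · N · ∂_v g) / g^(k+1)`. [folklore] -/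
noncomputable def quotDerivNum (f g : MvPolynomial ι R) : List ι → MvPolynomial ι R
  | [] => f
  | v :: w => g * pderiv v (quotDerivNum f g w) - (w.length + 1) • (quotDerivNum f g w * pderiv v g)

/-- The empty word: `quotDerivNum f g [] = f` (i.e. `g¹ · (f/g)`). [folklore] -/
@[simp] theorem quotDerivNum_nil (f g : MvPolynomial ι R) : quotDerivNum f g [] = f := rfl

/-- The quotient rule, one more derivative:
`quotDerivNum f g (v :: w) = g · ∂_v (quotDerivNum f g w) − (|w|+1) · quotDerivNum f g w · ∂_v g`.
[folklore] -/
@[simp] theorem quotDerivNum_cons (f g : MvPolynomial ι R) (v : ι) (w : List ι) :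
    quotDerivNum f g (v :: w) =
      g * pderiv v (quotDerivNum f g w) - (w.length + 1) • (quotDerivNum f g w * pderiv v g) := rfl

/-- `quotDerivNum` is additive in the numerator (`∂_w` and division by `g` are additive).
[folklore] -/
theorem quotDerivNum_add (f₁ f₂ g : MvPolynomial ι R) (w : List ι) :
    quotDerivNum (f₁ + f₂) g w = quotDerivNum f₁ g w + quotDerivNum f₂ g w := by
  induction w with
  | nil => rfl
  | cons v w ih =>
    simp only [quotDerivNum_cons, ih, map_add, mul_add, add_mul, smul_add]
    abel

/-- `quotDerivNum` vanishes on the zero numerator. [folklore] -/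
@[simp] theorem quotDerivNum_zero_left (g : MvPolynomial ι R) (w : List ι) :
    quotDerivNum 0 g w = 0 := by
  induction w with
  | nil => rfl
  | cons v w ih => simp only [quotDerivNum_cons, ih, map_zero, mul_zero, zero_mul, smul_zero,
      sub_zero]

/-- `quotDerivNum` commutes with a numerator factor `c` killed by every partial derivative used
(a "constant" for the word `w`): `quotDerivNum (c · f) g w = c · quotDerivNum f g w`. [folklore] -/
theorem quotDerivNum_const_mul (c f g : MvPolynomial ι R) (w : List ι)
    (hc : ∀ v ∈ w, pderiv v c = 0) :
    quotDerivNum (c * f) g w = c * quotDerivNum f g w := by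
  induction w with
  | nil => rfl
  | cons v w ih =>
    have hcv : pderiv v c = 0 := hc v (by simp)
    have hw : ∀ u ∈ w, pderiv u c = 0 := fun u hu => hc u (by simp [hu])
    simp only [quotDerivNum_cons, ih hw, Derivation.leibniz, hcv, smul_eq_mul]
    simp only [nsmul_eq_mul, Nat.cast_add, Nat.cast_one, add_zero, mul_zero]
    ring

/-- In particular for scalars: `quotDerivNum (C a · f) g w = C a · quotDerivNum f g w`. [folklore] -/
theorem quotDerivNum_C_mul (a : R) (f g : MvPolynomial ι R) (w : List ι) :
    quotDerivNum (C a * f) g w = C a * quotDerivNum f g w :=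
  quotDerivNum_const_mul (C a) f g w fun _ _ => pderiv_C

/-- `quotDerivNum` commutes with every change of coefficients (ring homomorphisms commute with
partial derivatives). [folklore] -/
theorem map_quotDerivNum {S : Type*} [CommRing S] (φ : R →+* S) (f g : MvPolynomial ι R)
    (w : List ι) :
    MvPolynomial.map φ (quotDerivNum f g w) =
      quotDerivNum (MvPolynomial.map φ f) (MvPolynomial.map φ g) w := by
  induction w with
  | nil => rfl
  | cons v w ih =>
    simp only [quotDerivNum_cons, map_sub, map_mul, map_nsmul, ← ih, pderiv_map]

end Summit.ValiantsHypothesis.ValiantsHypothesis.Theorems.ChowBorderBound.QuotDeriv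

namespace Summit.ValiantsHypothesis.ValiantsHypothesis.Theorems.ChowBorderBound.QuotDeriv

/-- Registered anchor of this definitions file on crux `stmt-ValiantsHypothesis-5936` (the
instance of `quotDerivNum_nil` over the crux's coefficient type): the empty word returns the
numerator. [folklore] -/
theorem quotDerivNum_nil_crux :
    ∀ (n : ℕ) (f g : MvPolynomial (Option (Fin n × Fin n)) ℂ),
      Summit.ValiantsHypothesis.ValiantsHypothesis.Theorems.ChowBorderBound.QuotDeriv.quotDerivNum
        f g [] = f :=
  fun _ _ _ => rfl

end Summit.ValiantsHypothesis.ValiantsHypothesis.Theorems.ChowBorderBound.QuotDeriv
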